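import Literature.RepresentationTheory.KonnoKonno2007.JunctionLinearRealGroup
import Literature.NumberTheory.Automorphic.GKModules
import Mathlib.Algebra.Lie.Semisimple.Defs
import HarnessLib

/-!
# The complex span of `𝔲(α, β)` is `𝔤𝔩(α ⊕ β, ℂ)`; irreducibility and skew-hermitian transport from a complex-linear action

Topic `RepresentationTheory/BorelWallach2000`; namespace `Literature.RepresentationTheory.BorelWallach2000`.
Theorems only (no definition, no named fact, no `sorry`).  The group is the real unitary group `U(α, β)` of the
hermitian form `D = diag(1_α, −1_β)` for ARBITRARY finite index types `α`, `β` — the tree's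
`KonnoKonno2007.uFormGroup α β : RealMatrixGroup ℂ (α ⊕ β)` with Lie algebra
`𝔲(α, β) = {X | Xᴴ D + D X = 0}` (`mem_uFormGroup_lie_iff`), `D = RealDualPair.signForm α β`, `Dᴴ = D`, `D² = 1`.

## Contents

* §1 **`𝔲(α, β)` is a real form of `𝔤𝔩(α ⊕ β, ℂ)`**: with the conjugate-linear involution `M ↦ −D Mᴴ D` one has
  `M ∈ 𝔲(α, β) ↔ D Mᴴ D = −M` (`upq_mem_lie_iff_signForm_conjTranspose_signForm`); every complex matrix `M` splits as
  `M = A + i B` with `A = ½ (M − D Mᴴ D) ∈ 𝔲(α, β)` and `B = −(i/2) (M + D Mᴴ D) ∈ 𝔲(α, β)`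
  (`upq_rePart_mem_lie`, `upq_imPart_mem_lie`, `upq_rePart_add_I_smul_imPart`, `upq_exists_eq_add_I_smul`); hence the
  **complex span of `𝔲(α, β)` is all of `𝔤𝔩(α ⊕ β, ℂ)`** (`upq_mem_span_lie`, `upq_span_lie_eq_top`).  For `α = Fin p`,
  `β = Fin q` this is the statement `𝔲(p, q)_ℂ = 𝔤𝔩(p + q, ℂ)` [cite: Knapp2002, I §1 Example (3)] (the example lists
  `𝔲(p, q)`; that its complexification is `𝔤𝔩(p+q, ℂ)` is the standard remark that `𝔲(p,q)` and `i 𝔲(p,q)` span).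
* §2 **Transport of invariant subspaces and of irreducibility.**  If a real Lie algebra action
  `ρ𝔤 : 𝔲(α, β) →ₗ⁅ℝ⁆ End_ℂ V` is the restriction of a COMPLEX-linear map `f : 𝔤𝔩(α ⊕ β, ℂ) →ₗ[ℂ] End_ℂ V`, then a complex
  subspace `W ≤ V` stable under all `ρ𝔤 X` is stable under all `f M` (`upq_forall_mem_of_forall_lie_mem`); consequently, if
  the only `f`-stable complex subspaces of a non-zero `V` are `⊥` and `⊤`, then `(ρK, ρ𝔤)` is an IRREDUCIBLE `(𝔤, K)`-module
  in the tree's sense `IsIrreducibleGK` for EVERY `K`-action `ρK` (`upq_isIrreducibleGK_of_forall_submodule`), and the same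
  when `V` is an irreducible Lie module (`LieModule.IsIrreducible`) over a complex Lie algebra `L` receiving a surjective
  complex-linear map `e : 𝔤𝔩(α ⊕ β, ℂ) → L` through which `ρ𝔤` acts, `ρ𝔤 X v = ⁅e X, v⁆`
  (`upq_isIrreducibleGK_of_lieModule_isIrreducible`).  This is the engine of the irreducibility half of the transport of
  Kovačević's kernel-checked irreducible `𝔤𝔩(3, ℂ)`-modules (`Kovacevic2021.SU21Irreducible`) to `(𝔲(2,1), K)`-modules:
  there `L = Matrix (Fin 3) (Fin 3) ℂ`, `e` = reindexing along `Fin 2 ⊕ Fin 1 ≃ Fin 3`.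
* §3 **Skew-hermitian transport.**  `X ∈ 𝔲(α, β)` entrywise (`upq_mem_lie_iff_entry`:
  `ε_i conj(X j i) ε_j = −X i j`, `ε = (1_α, −1_β)`), and: if a sesquilinear form `H` satisfies the matrix-unit adjoint
  relations `H (f E_{ij} v, w) = ε_i ε_j H (v, f E_{ji} w)` for a complex-linear `f` (Kovačević's unitarizability
  relations [cite: Kovacevic2021, §4 Thm 4]), then every `X ∈ 𝔲(α, β)` acts `H`-skew, `H (f X v, w) = −H (v, f X w)`
  (`upq_skew_of_matrixUnits`, `upq_skew_rho_of_matrixUnits`) — the invariant hermitian form of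
  [cite: BorelWallach2000, VI Thm 4.12] for the restricted real action.

## What is NOT here

* Nothing about the `K`-action: admissibility and the `(𝔤, K)`-axioms `IsGKModule` depend on `ρK` and are not
  consequences of the complex span.
* No complexification object `ℂ ⊗_ℝ 𝔲(α, β)` is introduced (the tree's `GKModules` deliberately avoids it, design note D3
  there); §1 is phrased inside `Matrix (α ⊕ β) (α ⊕ β) ℂ`.

## Sources

* A. W. Knapp, *Lie Groups Beyond an Introduction*, 2nd ed. (2002), I §1 Example (3) (`𝔲(p, q)`). [Knapp2002]
* N. R. Wallach, *Real Reductive Groups I* (1988), §3.3.1 (irreducible `(𝔤, K)`-modules) — via the tree's `GKModules`.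
* A. W. Knapp, D. A. Vogan, *Cohomological Induction and Unitary Representations* (1995), §II.4. [KnappVogan1995]
* A. Borel, N. Wallach, *Continuous cohomology, discrete subgroups, and representations of reductive groups*, 2nd ed.
  (2000), VI Thm. 4.12 (unitarity of the cohomological modules). [BorelWallach2000]
* D. Kovačević, *Unitary (𝔤, K)-modules of SU(2,1)*, Acta Math. Spalatensia 1 (2021), §4 Thm. 4 (the relations
  `⟨E_{ij} v, w⟩ = ε_i ε_j ⟨v, E_{ji} w⟩`). [Kovacevic2021]
-/

noncomputable section

open scoped Matrix MatrixGroups ComplexConjugate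

namespace Literature.RepresentationTheory.BorelWallach2000

open Literature.NumberTheory.Automorphic
open Literature.RepresentationTheory.KonnoKonno2007
open Literature.RepresentationTheory.KonnoKonno2007.RealDualPair
open Complex (I)

-- Mathlib idiom (as in `GKModules`, the `Upq*` files): commutator bracket on `Module.End` / matrices
attribute [local instance 100] LieRing.ofAssociativeRing

variable {α β : Type*} [Fintype α] [DecidableEq α] [Fintype β] [DecidableEq β]

/-! ## §1 The complex span of `𝔲(α, β)` -/

section ComplexSpan

/-- **Membership in `𝔲(α, β)` via the involution `M ↦ −D Mᴴ D`**: `M ∈ 𝔲(α, β) ↔ D Mᴴ D = −M`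
(`D = diag(1_α, −1_β)`, `D² = 1`). [cite: Knapp2002, I §1 Example (3)] -/
theorem upq_mem_lie_iff_signForm_conjTranspose_signForm (M : Matrix (α ⊕ β) (α ⊕ β) ℂ) :
    M ∈ (uFormGroup α β).lie ↔ signForm α β * Mᴴ * signForm α β = -M := by
  rw [mem_uFormGroup_lie_iff]
  constructor
  · intro h
    -- multiply `Mᴴ D + D M = 0` on the left by `D`
    have h' : signForm α β * (Mᴴ * signForm α β + signForm α β * M) = 0 := by rw [h, Matrix.mul_zero]
    rw [Matrix.mul_add, ← Matrix.mul_assoc, ← Matrix.mul_assoc, signForm_mul_signForm, Matrix.one_mul] at h'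
    exact eq_neg_of_add_eq_zero_left h'
  · intro h
    -- multiply `D Mᴴ D = −M` on the left by `D`
    have h' : signForm α β * (signForm α β * Mᴴ * signForm α β) = signForm α β * (-M) := by rw [h]
    rw [← Matrix.mul_assoc, ← Matrix.mul_assoc, signForm_mul_signForm, Matrix.one_mul, Matrix.mul_neg] at h'
    rw [h', neg_add_cancel]

/-- `(D Mᴴ D)ᴴ = D M D`. [folklore] -/
private theorem conjTranspose_signForm_mul_conjTranspose_mul_signForm (M : Matrix (α ⊕ β) (α ⊕ β) ℂ) :
    (signForm α β * Mᴴ * signForm α β)ᴴ = signForm α β * M * signForm α β := by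
  rw [Matrix.conjTranspose_mul, Matrix.conjTranspose_mul, conjTranspose_signForm,
    Matrix.conjTranspose_conjTranspose, Matrix.mul_assoc]

/-- `D (D M D) D = M` (`D² = 1`). [folklore] -/
private theorem signForm_mul_signForm_mul_mul_signForm_mul_signForm (M : Matrix (α ⊕ β) (α ⊕ β) ℂ) :
    signForm α β * (signForm α β * M * signForm α β) * signForm α β = M := by
  rw [← Matrix.mul_assoc, ← Matrix.mul_assoc, signForm_mul_signForm, Matrix.one_mul, Matrix.mul_assoc,
    signForm_mul_signForm, Matrix.mul_one]

/-- **The `𝔲(α, β)`-part of a complex matrix**: `A = ½ (M − D Mᴴ D) ∈ 𝔲(α, β)`.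
[cite: Knapp2002, I §1 Example (3)] -/
theorem upq_rePart_mem_lie (M : Matrix (α ⊕ β) (α ⊕ β) ℂ) :
    (2⁻¹ : ℂ) • (M - signForm α β * Mᴴ * signForm α β) ∈ (uFormGroup α β).lie := by
  rw [upq_mem_lie_iff_signForm_conjTranspose_signForm, Matrix.conjTranspose_smul, Matrix.conjTranspose_sub,
    conjTranspose_signForm_mul_conjTranspose_mul_signForm, Matrix.mul_smul, Matrix.smul_mul, Matrix.mul_sub,
    Matrix.sub_mul, signForm_mul_signForm_mul_mul_signForm_mul_signForm, ← smul_neg, neg_sub]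
  congr 1
  rw [Complex.star_def, map_inv₀, map_ofNat]

/-- **The `i 𝔲(α, β)`-part of a complex matrix**: `B = −(i/2) (M + D Mᴴ D) ∈ 𝔲(α, β)`.
[cite: Knapp2002, I §1 Example (3)] -/
theorem upq_imPart_mem_lie (M : Matrix (α ⊕ β) (α ⊕ β) ℂ) :
    (-(I / 2)) • (M + signForm α β * Mᴴ * signForm α β) ∈ (uFormGroup α β).lie := by
  rw [upq_mem_lie_iff_signForm_conjTranspose_signForm, Matrix.conjTranspose_smul, Matrix.conjTranspose_add,
    conjTranspose_signForm_mul_conjTranspose_mul_signForm, Matrix.mul_smul, Matrix.smul_mul, Matrix.mul_add,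
    Matrix.add_mul, signForm_mul_signForm_mul_mul_signForm_mul_signForm, ← neg_smul, add_comm]
  congr 1
  rw [star_neg, neg_neg, star_div₀, Complex.star_def, Complex.conj_I, map_ofNat, neg_div, neg_neg]

/-- **`M = A + i B`** with `A = ½ (M − D Mᴴ D)`, `B = −(i/2) (M + D Mᴴ D)` (the real-form decomposition of
`𝔤𝔩(α ⊕ β, ℂ)` along `𝔲(α, β)`). [cite: Knapp2002, I §1 Example (3)] -/
theorem upq_rePart_add_I_smul_imPart (M : Matrix (α ⊕ β) (α ⊕ β) ℂ) :
    (2⁻¹ : ℂ) • (M - signForm α β * Mᴴ * signForm α β) +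
        I • ((-(I / 2)) • (M + signForm α β * Mᴴ * signForm α β)) = M := by
  rw [smul_smul, show I * -(I / 2) = (2⁻¹ : ℂ) by
    rw [mul_neg, mul_div_assoc', Complex.I_mul_I, neg_div, neg_neg, one_div]]
  rw [smul_sub, smul_add, sub_add_add_cancel, ← two_smul ℂ, smul_smul]
  norm_num

/-- **Every complex matrix is `A + i B` with `A, B ∈ 𝔲(α, β)`** — `𝔲(α, β)` is a real form of `𝔤𝔩(α ⊕ β, ℂ)`.
[cite: Knapp2002, I §1 Example (3)] -/
theorem upq_exists_eq_add_I_smul (M : Matrix (α ⊕ β) (α ⊕ β) ℂ) :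
    ∃ A B : (uFormGroup α β).lie,
      M = (A : Matrix (α ⊕ β) (α ⊕ β) ℂ) + I • (B : Matrix (α ⊕ β) (α ⊕ β) ℂ) :=
  ⟨⟨_, upq_rePart_mem_lie M⟩, ⟨_, upq_imPart_mem_lie M⟩, (upq_rePart_add_I_smul_imPart M).symm⟩

/-- Every complex matrix lies in the complex span of `𝔲(α, β)`. [cite: Knapp2002, I §1 Example (3)] -/
theorem upq_mem_span_lie (M : Matrix (α ⊕ β) (α ⊕ β) ℂ) :
    M ∈ Submodule.span ℂ ((uFormGroup α β).lie : Set (Matrix (α ⊕ β) (α ⊕ β) ℂ)) := by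
  obtain ⟨A, B, rfl⟩ := upq_exists_eq_add_I_smul M
  exact Submodule.add_mem _ (Submodule.subset_span A.2) (Submodule.smul_mem _ _ (Submodule.subset_span B.2))

/-- **The complex span of `𝔲(α, β)` is `𝔤𝔩(α ⊕ β, ℂ)`**: `span_ℂ 𝔲(α, β) = ⊤`. [cite: Knapp2002, I §1 Example (3)] -/
theorem upq_span_lie_eq_top :
    Submodule.span ℂ ((uFormGroup α β).lie : Set (Matrix (α ⊕ β) (α ⊕ β) ℂ)) = ⊤ :=
  Submodule.eq_top_iff'.2 upq_mem_span_lie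

end ComplexSpan

/-! ## §2 Transport of invariant subspaces and of irreducibility from a complex-linear action -/

section Transport

variable {V : Type*} [AddCommGroup V] [Module ℂ V]

/-- **Invariant complex subspaces see all of `𝔤𝔩(α ⊕ β, ℂ)`**: if `f : 𝔤𝔩(α ⊕ β, ℂ) → End_ℂ V` is complex-linear and
a complex subspace `W` is stable under `f X` for every `X ∈ 𝔲(α, β)`, then `W` is stable under `f M` for every complex
matrix `M` (write `M = A + i B`, §1). [cite: Knapp2002, I §1 Example (3)] -/
theorem upq_forall_mem_of_forall_lie_mem (f : Matrix (α ⊕ β) (α ⊕ β) ℂ →ₗ[ℂ] Module.End ℂ V)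
    (W : Submodule ℂ V) (h : ∀ X : (uFormGroup α β).lie, ∀ w ∈ W, f (X : Matrix (α ⊕ β) (α ⊕ β) ℂ) w ∈ W)
    (M : Matrix (α ⊕ β) (α ⊕ β) ℂ) : ∀ w ∈ W, f M w ∈ W := by
  intro w hw
  obtain ⟨A, B, rfl⟩ := upq_exists_eq_add_I_smul M
  rw [map_add, map_smul, LinearMap.add_apply, LinearMap.smul_apply]
  exact W.add_mem (h A w hw) (W.smul_mem I (h B w hw))

/-- A complex subspace stable under a real Lie algebra action `ρ𝔤` of `𝔲(α, β)` that is the restriction of a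
complex-linear `f` is stable under all `f M`. [cite: Knapp2002, I §1 Example (3)] -/
theorem upq_forall_mem_of_forall_rho_mem (ρ𝔤 : (uFormGroup α β).lie →ₗ⁅ℝ⁆ Module.End ℂ V)
    (f : Matrix (α ⊕ β) (α ⊕ β) ℂ →ₗ[ℂ] Module.End ℂ V)
    (hf : ∀ X : (uFormGroup α β).lie, ρ𝔤 X = f (X : Matrix (α ⊕ β) (α ⊕ β) ℂ))
    (W : Submodule ℂ V) (h : ∀ X : (uFormGroup α β).lie, ∀ w ∈ W, ρ𝔤 X w ∈ W)
    (M : Matrix (α ⊕ β) (α ⊕ β) ℂ) : ∀ w ∈ W, f M w ∈ W :=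
  upq_forall_mem_of_forall_lie_mem f W (fun X w hw => by rw [← hf]; exact h X w hw) M

/-- **Irreducibility transport** (Wallach §3.3.1 notion `IsIrreducibleGK`): if the `𝔲(α, β)`-action `ρ𝔤` of a
non-zero complex vector space is the restriction of a complex-linear `f : 𝔤𝔩(α ⊕ β, ℂ) → End_ℂ V` whose only stable
complex subspaces are `⊥` and `⊤`, then `(ρK, ρ𝔤)` is an irreducible `(𝔤, K)`-module for EVERY `K`-action `ρK`
(a `(𝔤, K)`-submodule is in particular `ρ𝔤`-stable, hence `f`-stable by §1) — the bridge between Wallach's irreducible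
`(𝔤₀, K)`-modules over the REAL Lie algebra (the tree's `IsIrreducibleGK`) and irreducibility over the complexified Lie
algebra as in Knapp–Vogan. [cite: KnappVogan1995, §II.4 (after Cor. 2.78)] -/
theorem upq_isIrreducibleGK_of_forall_submodule [Nontrivial V]
    (ρK : Representation ℂ (uFormGroup α β).maximalCompact V)
    (ρ𝔤 : (uFormGroup α β).lie →ₗ⁅ℝ⁆ Module.End ℂ V) (f : Matrix (α ⊕ β) (α ⊕ β) ℂ →ₗ[ℂ] Module.End ℂ V)
    (hf : ∀ X : (uFormGroup α β).lie, ρ𝔤 X = f (X : Matrix (α ⊕ β) (α ⊕ β) ℂ))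
    (hirr : ∀ W : Submodule ℂ V, (∀ M : Matrix (α ⊕ β) (α ⊕ β) ℂ, ∀ w ∈ W, f M w ∈ W) → W = ⊥ ∨ W = ⊤) :
    IsIrreducibleGK ρK ρ𝔤 :=
  ⟨inferInstance, fun W hW => hirr W (upq_forall_mem_of_forall_rho_mem ρ𝔤 f hf W hW.2)⟩

/-- **Irreducibility transport from an irreducible complex Lie module**: let `L` be a complex Lie algebra acting on
`V` with `V` an irreducible Lie module (`LieModule.IsIrreducible ℂ L V`), `e : 𝔤𝔩(α ⊕ β, ℂ) →ₗ[ℂ] L` SURJECTIVE, and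
suppose the `𝔲(α, β)`-action is `ρ𝔤 X v = ⁅e X, v⁆`.  Then `(ρK, ρ𝔤)` is an irreducible `(𝔤, K)`-module for every
`K`-action `ρK`.  (Used with `L = Matrix (Fin 3) (Fin 3) ℂ` and `e` the reindexing `Fin 2 ⊕ Fin 1 ≃ Fin 3` to transport
Kovačević's irreducible `𝔤𝔩(3, ℂ)`-modules to `U(2,1)`.) [cite: KnappVogan1995, §II.4 (after Cor. 2.78)] -/
theorem upq_isIrreducibleGK_of_lieModule_isIrreducible {L : Type*} [LieRing L] [LieAlgebra ℂ L]
    [LieRingModule L V] [LieModule ℂ L V] [hV : LieModule.IsIrreducible ℂ L V]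
    (e : Matrix (α ⊕ β) (α ⊕ β) ℂ →ₗ[ℂ] L) (he : Function.Surjective e)
    (ρK : Representation ℂ (uFormGroup α β).maximalCompact V)
    (ρ𝔤 : (uFormGroup α β).lie →ₗ⁅ℝ⁆ Module.End ℂ V)
    (hρ : ∀ (X : (uFormGroup α β).lie) (v : V), ρ𝔤 X v = ⁅e (X : Matrix (α ⊕ β) (α ⊕ β) ℂ), v⁆) :
    IsIrreducibleGK ρK ρ𝔤 := by
  haveI : Nontrivial V := (LieSubmodule.nontrivial_iff ℂ L V).mp hV.toNontrivial
  -- the complex-linear action `M ↦ ad (e M)` restricting to `ρ𝔤`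
  let f : Matrix (α ⊕ β) (α ⊕ β) ℂ →ₗ[ℂ] Module.End ℂ V := (LieModule.toEnd ℂ L V : L →ₗ[ℂ] Module.End ℂ V) ∘ₗ e
  have hf : ∀ X : (uFormGroup α β).lie, ρ𝔤 X = f (X : Matrix (α ⊕ β) (α ⊕ β) ℂ) := by
    intro X
    ext v
    rw [hρ]
    rfl
  refine upq_isIrreducibleGK_of_forall_submodule ρK ρ𝔤 f hf fun W hW => ?_
  -- `W` is stable under every `⁅l, ·⁆`, `l ∈ L` (`e` surjective): it is a Lie submodule
  have hlie : ∀ (l : L), ∀ w ∈ W, ⁅l, w⁆ ∈ W := by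
    intro l w hw
    obtain ⟨M, rfl⟩ := he l
    exact hW M w hw
  let N : LieSubmodule ℂ L V := { W with lie_mem := fun {l} {w} hw => hlie l w hw }
  rcases hV.eq_bot_or_eq_top N with hN | hN
  · left
    exact (LieSubmodule.toSubmodule_eq_bot N).mpr hN
  · right
    exact (LieSubmodule.toSubmodule_eq_top N).mpr hN

end Transport

/-! ## §3 Skew-hermitian transport: an invariant hermitian form from matrix-unit adjoint relations -/

section SkewHermitian

variable {V : Type*} [AddCommGroup V] [Module ℂ V]

/-- **Membership in `𝔲(α, β)` entrywise**: `X ∈ 𝔲(α, β)` iff `ε_i · conj (X j i) · ε_j = −X i j` for all `i, j`,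
where `ε = (1_α, −1_β)` are the diagonal entries of `D`. [cite: Knapp2002, I §1 Example (3)] -/
theorem upq_mem_lie_iff_entry (X : Matrix (α ⊕ β) (α ⊕ β) ℂ) :
    X ∈ (uFormGroup α β).lie ↔ ∀ i j : α ⊕ β,
      Sum.elim (fun _ => (1 : ℂ)) (fun _ => -1) i * starRingEnd ℂ (X j i) *
        Sum.elim (fun _ => (1 : ℂ)) (fun _ => -1) j = -X i j := by
  rw [upq_mem_lie_iff_signForm_conjTranspose_signForm, signForm_eq_diagonal, ← Matrix.ext_iff]
  refine forall_congr' fun i => forall_congr' fun j => ?_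
  rw [Matrix.mul_diagonal, Matrix.diagonal_mul, Matrix.conjTranspose_apply, Matrix.neg_apply]
  rfl

/-- **Skew-hermitian transport from matrix units.**  Let `f : 𝔤𝔩(α ⊕ β, ℂ) → End_ℂ V` be complex-linear and `H` a
sesquilinear form (conjugate-linear in the first variable) with the matrix-unit adjoint relations
`H (f E_{ij} v, w) = ε_i ε_j H (v, f E_{ji} w)` (`ε = (1_α, −1_β)`) — the unitarizability relations of Kovačević for the
real form `𝔲(2,1)` of `𝔤𝔩(3, ℂ)`.  Then every `X ∈ 𝔲(α, β)` acts by an `H`-SKEW operator: `H (f X v, w) = −H (v, f X w)`.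
(With §2 this turns Kovačević's ★ `SU21Datum.IsUnitarizable` into the tree's `HasInvariantHermitianForm` for the
restricted real action.) [cite: BorelWallach2000, VI Thm 4.12] [cite: Kovacevic2021, §4 Thm 4] -/
theorem upq_skew_of_matrixUnits (f : Matrix (α ⊕ β) (α ⊕ β) ℂ →ₗ[ℂ] Module.End ℂ V)
    (H : V →ₗ⋆[ℂ] V →ₗ[ℂ] ℂ)
    (hE : ∀ (i j : α ⊕ β) (v w : V), H (f (Matrix.single i j 1) v) w =
      Sum.elim (fun _ => (1 : ℂ)) (fun _ => -1) i * Sum.elim (fun _ => (1 : ℂ)) (fun _ => -1) j *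
        H v (f (Matrix.single j i 1) w))
    (X : Matrix (α ⊕ β) (α ⊕ β) ℂ) (hX : X ∈ (uFormGroup α β).lie) (v w : V) :
    H (f X v) w = -H v (f X w) := by
  rw [upq_mem_lie_iff_entry] at hX
  have hXsum : X = ∑ i, ∑ j, X i j • Matrix.single i j (1 : ℂ) := by
    conv_lhs => rw [Matrix.matrix_eq_sum_single X]
    simp only [Matrix.smul_single, smul_eq_mul, mul_one]
  rw [hXsum]
  simp only [map_sum, LinearMap.map_smulₛₗ, map_smul, LinearMap.sum_apply, LinearMap.smul_apply, smul_eq_mul]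
  rw [Finset.sum_comm, ← Finset.sum_neg_distrib]
  refine Finset.sum_congr rfl fun i _ => ?_
  rw [← Finset.sum_neg_distrib]
  refine Finset.sum_congr rfl fun j _ => ?_
  rw [hE j i v w]
  linear_combination (H v (f (Matrix.single i j 1) w)) * hX i j

/-- The same for a real Lie algebra action `ρ𝔤` of `𝔲(α, β)` that is the restriction of `f`: an invariant
(skew) hermitian form in the sense of the tree's `(𝔤, K)`-module files. [cite: BorelWallach2000, VI Thm 4.12] -/
theorem upq_skew_rho_of_matrixUnits (ρ𝔤 : (uFormGroup α β).lie →ₗ⁅ℝ⁆ Module.End ℂ V)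
    (f : Matrix (α ⊕ β) (α ⊕ β) ℂ →ₗ[ℂ] Module.End ℂ V)
    (hf : ∀ X : (uFormGroup α β).lie, ρ𝔤 X = f (X : Matrix (α ⊕ β) (α ⊕ β) ℂ))
    (H : V →ₗ⋆[ℂ] V →ₗ[ℂ] ℂ)
    (hE : ∀ (i j : α ⊕ β) (v w : V), H (f (Matrix.single i j 1) v) w =
      Sum.elim (fun _ => (1 : ℂ)) (fun _ => -1) i * Sum.elim (fun _ => (1 : ℂ)) (fun _ => -1) j *
        H v (f (Matrix.single j i 1) w))
    (X : (uFormGroup α β).lie) (v w : V) : H (ρ𝔤 X v) w = -H v (ρ𝔤 X w) := by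
  rw [hf]
  exact upq_skew_of_matrixUnits f H hE X X.2 v w

end SkewHermitian

end Literature.RepresentationTheory.BorelWallach2000
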